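import Literature.Geometry.Symplectic.OrigamiUnfoldingProofs
import Literature.Geometry.Manifold.FreeCircleAction
import Literature.Topology.FourManifolds.KnotFraming
import HarnessLib

/-!
# The null foliation of a folded / origami form on a 4-manifold (Def. 2.1–2.2)

Second proofs companion of `OrigamiUnfolding.lean` (fact seat of
`Literature.Geometry.Symplectic.exists_symplecticCutPieces_of_isOrigamiForm`, triage `XL`; see the
module docstring of `OrigamiUnfoldingProofs.lean` for the architecture of the printed proof and
what is missing). A. Cannas da Silva, V. Guillemin, A. R. Pires, *Symplectic Origami*, IMRN 2011 =
arXiv:0909.4065, §2.1, after Def. 2.1 (read, p. 5 of the arXiv text): "The induced restriction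
`i*ω` has a one-dimensional kernel at each point: the line field `V` on `Z`, called the null
foliation. Note that `V = TZ ∩ E ⊂ i*TM` where `E` is the rank 2 bundle over `Z` whose fiber at
each point is the kernel of `ω`"; Def. 2.2: an origami form is one "whose null foliation
integrates to a principal `S¹`-fibration"; after Def. 2.5: "The null foliation `V` is the vertical
bundle of `π`". These are the facts about the fold that steps (S1) (a connection form `α` with
`α(X) = 1` for the generator `X`) and (S2) (`i*ω = π* ω_B` with `ω_B` non-degenerate) of the
unfolding consume. This file proves them for the tree's rendering `IsFoldedForm` / `IsOrigamiForm`
(`OrigamiForm.lean`), in which the hypersurface `j : N ↪ M` and the free circle action `θ` are data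
and "maximal rank" is the clause `ker ω ⊄ TZ`:

* linear algebra on `ℝ⁴` (`altKer α`, the radical of a `2`-form, as a `Submodule`):
  `finrank_altKer_le_two` (a non-zero form), `pfaffAdjCol`, `alt_two_pfaffAdjCol` (the Pfaffian
  adjugate `α(c_k, ·) = -Pf(α) e^k`), `two_le_finrank_altKer` (a degenerate non-zero form),
  **`finrank_altKer_eq_two`** — `Pf α = 0`, `α ≠ 0 ⇒ dim ker α = 2` (rank of an alternating form is
  even);
* `pfaffian_neg`, `fderiv_pfaffian_zero` (`dPf(0) = 0`, `Pf` being even) and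
  **`IsFoldedForm.apply_ne_zero`**: `ω_x ≠ 0` at fold points (else the chart Pfaffian would have
  zero derivative at the centre, against `ω ∧ ω ⋔ 0`); hence `IsFoldedForm.finrank_altKer`:
  **`E = ker ω` is a `2`-plane along the fold**;
* `IsFoldedForm.finrank_range_mfderiv` (`dim TZ = 3`, `j` an immersion — the tree's
  `Manifold.IsImmersionAt.mfderiv_injective`, `Topology/FourManifolds/KnotFraming.lean`) and
  **`IsFoldedForm.finrank_altKer_inf_range`**: `dim (E ∩ TZ) = 1` — **the null line field**
  (`E ⊄ TZ` by maximal rank, so `E + TZ = ℝ⁴`, and Grassmann's formula);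
* with the free circle action (`Literature/Geometry/Manifold/FreeCircleAction.lean`: the
  fundamental vector of a free smooth circle action does not vanish):
  `mfderiv_comp_circleOrbit_apply` (chain rule), `mfderiv_comp_circleOrbit_ne_zero`,
  `mfderiv_comp_circleOrbit_mem_range`, and **`IsFoldedForm.altKer_inf_span_range_eq_span`** —
  for fold data `(N, j, θ)` as in `IsOrigamiForm` the null line at `j n` is spanned by the
  velocity `d/dt|₀ j (θ (exp t) n)` of the orbit: **the null foliation is the vertical bundle of
  the null fibration**;
* `IsOrigamiForm.apply_ne_zero`, `IsOrigamiForm.finrank_altKer` — the data-free corollaries.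

Everything is proved; the only definitions are `altKer` and `pfaffAdjCol`; no named facts.

## References

* [CannasdasilvaGuilleminPires2010] A. Cannas da Silva, V. Guillemin, A. R. Pires, *Symplectic
  Origami*, IMRN 2011, 4252–4293 = arXiv:0909.4065, §2.1 (Def. 2.1, the null foliation), Def. 2.2,
  discussion after Def. 2.5.
* J. M. Lee, *Introduction to Smooth Manifolds*, 2nd ed. (2012), Prop. 21.7 (orbit maps of free
  proper actions are embeddings). [LeeSmoothManifolds2013]
-/

noncomputable section

open scoped Manifold ContDiff Topology
open Set Function Module
open Literature.Geometry.Kaehler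

namespace Literature.Geometry.Symplectic

/-! ### The radical of a 2-form on `ℝ⁴` -/

section AltKer

variable (α : (EuclideanSpace ℝ (Fin 4)) [⋀^Fin 2]→L[ℝ] ℝ)

/-- The **radical** (kernel) `{v | α(v, ·) = 0}` of a 2-form on `ℝ⁴`, as a submodule — at a fold
point of a folded form this is the fibre of the bundle `E` of Def. 2.1 ("`E` is the rank 2 bundle
over `Z` whose fiber at each point is the kernel of `ω`"). [cite: CannasdasilvaGuilleminPires2010, Def. 2.1] -/
def altKer : Submodule ℝ (EuclideanSpace ℝ (Fin 4)) where
  carrier := {v | ∀ w, α ![v, w] = 0}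
  add_mem' {a b} ha hb := fun w => by
    have ha' : α ![a, w] = 0 := ha w
    have hb' : α ![b, w] = 0 := hb w
    rw [alt_two_add_left, ha', hb', add_zero]
  zero_mem' := fun w => by
    have h := alt_two_smul_left α 0 0 w
    rwa [zero_smul, zero_mul] at h
  smul_mem' c v hv := fun w => by
    have hv' : α ![v, w] = 0 := hv w
    change α ![c • v, w] = 0
    rw [alt_two_smul_left, hv', mul_zero]

/-- Membership in the radical. [folklore] -/
theorem mem_altKer_iff {v : EuclideanSpace ℝ (Fin 4)} : v ∈ altKer α ↔ ∀ w, α ![v, w] = 0 :=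
  Iff.rfl

/-- A 2-form vanishes iff it vanishes on all pairs `![v, w]`. [folklore] -/
theorem alt_two_eq_zero_iff : α = 0 ↔ ∀ v w, α ![v, w] = 0 := by
  constructor
  · rintro rfl v w
    rfl
  · intro h
    ext m
    have hm : m = ![m 0, m 1] := by
      funext i
      fin_cases i <;> rfl
    rw [hm]
    exact h _ _

/-- A non-zero 2-form on `ℝ⁴` has a non-zero coefficient `α(eᵢ, eⱼ)` (double expansion
`alt_two_sum`). [folklore] -/
theorem exists_stdVec_ne_zero (hα : α ≠ 0) : ∃ i j : Fin 4, α ![stdVec i, stdVec j] ≠ 0 := by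
  by_contra h
  push Not at h
  apply hα
  rw [alt_two_eq_zero_iff]
  intro v w
  rw [alt_two_sum]
  simp [h]

/-- `Pf α = 0` iff the radical is non-trivial (`pfaffian_eq_zero_iff`). [folklore] -/
theorem pfaffian_eq_zero_iff_altKer_ne_bot : pfaffian α = 0 ↔ altKer α ≠ ⊥ := by
  rw [pfaffian_eq_zero_iff, Ne, Submodule.eq_bot_iff]
  push Not
  constructor
  · rintro ⟨v, hv0, hv⟩
    exact ⟨v, hv, hv0⟩
  · rintro ⟨v, hv, hv0⟩
    exact ⟨v, hv0, hv⟩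

/-- The standard vectors `eᵢ`, `eⱼ` (`i ≠ j`) of `ℝ⁴` are linearly independent. [folklore] -/
theorem linearIndependent_stdVec_pair {i j : Fin 4} (hij : i ≠ j) :
    LinearIndependent ℝ ![stdVec i, stdVec j] := by
  rw [LinearIndependent.pair_iff]
  intro s t hst
  have hi := congrArg (fun v : EuclideanSpace ℝ (Fin 4) => v i) hst
  have hj := congrArg (fun v : EuclideanSpace ℝ (Fin 4) => v j) hst
  simp [stdVec_apply, hij, hij.symm] at hi hj
  exact ⟨hi, hj⟩

/-- If `α(eᵢ, eⱼ) ≠ 0`, the plane `⟨eᵢ, eⱼ⟩` meets the radical trivially (`α` restricted to it is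
non-degenerate). [folklore] -/
theorem span_pair_inf_altKer_eq_bot {i j : Fin 4} (h : α ![stdVec i, stdVec j] ≠ 0) :
    Submodule.span ℝ (Set.range ![stdVec i, stdVec j]) ⊓ altKer α = ⊥ := by
  rw [Submodule.eq_bot_iff]
  rintro v ⟨hv, hk⟩
  obtain ⟨c, rfl⟩ := (Submodule.mem_span_range_iff_exists_fun ℝ).1 hv
  simp only [Fin.sum_univ_two, Matrix.cons_val_zero, Matrix.cons_val_one] at hk ⊢
  have h1 : α ![c 0 • stdVec i + c 1 • stdVec j, stdVec j] = 0 := hk (stdVec j)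
  have h2 : α ![c 0 • stdVec i + c 1 • stdVec j, stdVec i] = 0 := hk (stdVec i)
  rw [alt_two_add_left, alt_two_smul_left, alt_two_smul_left, alt_two_self, mul_zero,
    add_zero] at h1
  rw [alt_two_add_left, alt_two_smul_left, alt_two_smul_left, alt_two_self, mul_zero, zero_add,
    alt_two_swap, mul_neg, neg_eq_zero] at h2
  have hx : c 0 = 0 := (mul_eq_zero.1 h1).resolve_right h
  have hy : c 1 = 0 := (mul_eq_zero.1 h2).resolve_right h
  simp [hx, hy]

/-- **The radical of a non-zero 2-form on `ℝ⁴` has dimension at most `2`**: it misses a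
coordinate plane on which `α` is non-degenerate (Grassmann's formula). [folklore] -/
theorem finrank_altKer_le_two (hα : α ≠ 0) : finrank ℝ (altKer α) ≤ 2 := by
  obtain ⟨i, j, h⟩ := exists_stdVec_ne_zero α hα
  have hij : i ≠ j := by
    rintro rfl
    exact h (alt_two_self α _)
  set W := Submodule.span ℝ (Set.range ![stdVec i, stdVec j]) with hW
  have hW2 : finrank ℝ W = 2 := by
    rw [hW, finrank_span_eq_card (linearIndependent_stdVec_pair hij)]
    simp
  have hinf : W ⊓ altKer α = ⊥ := span_pair_inf_altKer_eq_bot α h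
  have key := Submodule.finrank_sup_add_finrank_inf_eq W (altKer α)
  rw [hinf, finrank_bot, add_zero, hW2] at key
  have hle : finrank ℝ ↥(W ⊔ altKer α) ≤ 4 := by
    have := Submodule.finrank_le (W ⊔ altKer α)
    rwa [finrank_euclideanSpace_fin] at this
  omega

/-- The columns of the **Pfaffian adjugate** of `α`: `c₀ = (0, a₂₃, -a₁₃, a₁₂)`,
`c₁ = (-a₂₃, 0, a₀₃, -a₀₂)`, `c₂ = (a₁₃, -a₀₃, 0, a₀₁)`, `c₃ = (-a₁₂, a₀₂, -a₀₁, 0)`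
(`aᵢⱼ = α(eᵢ, eⱼ)`); they satisfy `α(c_k, w) = -Pf(α) w_k` (`A · A^∨ = -Pf(A) · 1`, the same
vectors as in `exists_forall_eq_zero_of_pfaffian_eq_zero` of `PfaffianFour.lean`). [folklore] -/
def pfaffAdjCol : Fin 4 → EuclideanSpace ℝ (Fin 4) :=
  ![WithLp.toLp 2 ![0, α ![stdVec 2, stdVec 3], -α ![stdVec 1, stdVec 3], α ![stdVec 1, stdVec 2]],
    WithLp.toLp 2 ![-α ![stdVec 2, stdVec 3], 0, α ![stdVec 0, stdVec 3], -α ![stdVec 0, stdVec 2]],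
    WithLp.toLp 2 ![α ![stdVec 1, stdVec 3], -α ![stdVec 0, stdVec 3], 0, α ![stdVec 0, stdVec 1]],
    WithLp.toLp 2 ![-α ![stdVec 1, stdVec 2], α ![stdVec 0, stdVec 2], -α ![stdVec 0, stdVec 1], 0]]

/-- **The Pfaffian adjugate identity** `α(c_k, w) = -Pf(α) · w_k`. [folklore] -/
theorem alt_two_pfaffAdjCol (k : Fin 4) (w : EuclideanSpace ℝ (Fin 4)) :
    α ![pfaffAdjCol α k, w] = -pfaffian α * w k := by
  unfold pfaffian
  fin_cases k <;>
  · rw [alt_two_apply_eq]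
    simp [pfaffAdjCol]
    ring

/-- When `Pf α = 0` the adjugate columns lie in the radical. [folklore] -/
theorem pfaffAdjCol_mem_altKer (hP : pfaffian α = 0) (k : Fin 4) : pfaffAdjCol α k ∈ altKer α :=
  fun w => by rw [alt_two_pfaffAdjCol, hP, neg_zero, zero_mul]

/-- Two adjugate columns are independent as soon as the complementary coefficient is non-zero:
if `α(eᵢ, eⱼ) ≠ 0` for `{i, j, k, l} = {0, 1, 2, 3}` then `c_k`, `c_l` are independent (their
`(k, l)`-minor is `±α(eᵢ, eⱼ)²`). [folklore] -/
theorem exists_linearIndependent_pfaffAdjCol (hα : α ≠ 0) :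
    ∃ k l : Fin 4, LinearIndependent ℝ ![pfaffAdjCol α k, pfaffAdjCol α l] := by
  obtain ⟨i, j, h⟩ := exists_stdVec_ne_zero α hα
  -- independence test through two coordinates
  have test : ∀ (k l p q : Fin 4), (pfaffAdjCol α k p = 0) → (pfaffAdjCol α l q = 0) →
      pfaffAdjCol α k q ≠ 0 → pfaffAdjCol α l p ≠ 0 →
      LinearIndependent ℝ ![pfaffAdjCol α k, pfaffAdjCol α l] := by
    intro k l p q hkp hlq hkq hlp
    rw [LinearIndependent.pair_iff]
    intro s t hst
    have ep := congrArg (fun v : EuclideanSpace ℝ (Fin 4) => v p) hst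
    have eq := congrArg (fun v : EuclideanSpace ℝ (Fin 4) => v q) hst
    simp only [PiLp.add_apply, PiLp.smul_apply, smul_eq_mul, hkp, hlq, mul_zero, zero_add,
      add_zero, PiLp.zero_apply] at ep eq
    exact ⟨(mul_eq_zero.1 eq).resolve_right hkq, (mul_eq_zero.1 ep).resolve_right hlp⟩
  have hji : α ![stdVec j, stdVec i] ≠ 0 := by
    rw [alt_two_swap]; exact neg_ne_zero.2 h
  fin_cases i <;> fin_cases j
  all_goals first
    | exact absurd (alt_two_self α _) h
    | exact ⟨2, 3, test 2 3 2 3 (by simp [pfaffAdjCol]) (by simp [pfaffAdjCol])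
        (by simpa [pfaffAdjCol] using h) (by simpa [pfaffAdjCol] using h)⟩
    | exact ⟨2, 3, test 2 3 2 3 (by simp [pfaffAdjCol]) (by simp [pfaffAdjCol])
        (by simpa [pfaffAdjCol] using hji) (by simpa [pfaffAdjCol] using hji)⟩
    | exact ⟨1, 3, test 1 3 1 3 (by simp [pfaffAdjCol]) (by simp [pfaffAdjCol])
        (by simpa [pfaffAdjCol] using h) (by simpa [pfaffAdjCol] using h)⟩
    | exact ⟨1, 3, test 1 3 1 3 (by simp [pfaffAdjCol]) (by simp [pfaffAdjCol])
        (by simpa [pfaffAdjCol] using hji) (by simpa [pfaffAdjCol] using hji)⟩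
    | exact ⟨1, 2, test 1 2 1 2 (by simp [pfaffAdjCol]) (by simp [pfaffAdjCol])
        (by simpa [pfaffAdjCol] using h) (by simpa [pfaffAdjCol] using h)⟩
    | exact ⟨1, 2, test 1 2 1 2 (by simp [pfaffAdjCol]) (by simp [pfaffAdjCol])
        (by simpa [pfaffAdjCol] using hji) (by simpa [pfaffAdjCol] using hji)⟩
    | exact ⟨0, 3, test 0 3 0 3 (by simp [pfaffAdjCol]) (by simp [pfaffAdjCol])
        (by simpa [pfaffAdjCol] using h) (by simpa [pfaffAdjCol] using h)⟩
    | exact ⟨0, 3, test 0 3 0 3 (by simp [pfaffAdjCol]) (by simp [pfaffAdjCol])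
        (by simpa [pfaffAdjCol] using hji) (by simpa [pfaffAdjCol] using hji)⟩
    | exact ⟨0, 2, test 0 2 0 2 (by simp [pfaffAdjCol]) (by simp [pfaffAdjCol])
        (by simpa [pfaffAdjCol] using h) (by simpa [pfaffAdjCol] using h)⟩
    | exact ⟨0, 2, test 0 2 0 2 (by simp [pfaffAdjCol]) (by simp [pfaffAdjCol])
        (by simpa [pfaffAdjCol] using hji) (by simpa [pfaffAdjCol] using hji)⟩
    | exact ⟨0, 1, test 0 1 0 1 (by simp [pfaffAdjCol]) (by simp [pfaffAdjCol])
        (by simpa [pfaffAdjCol] using h) (by simpa [pfaffAdjCol] using h)⟩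
    | exact ⟨0, 1, test 0 1 0 1 (by simp [pfaffAdjCol]) (by simp [pfaffAdjCol])
        (by simpa [pfaffAdjCol] using hji) (by simpa [pfaffAdjCol] using hji)⟩

/-- **The radical of a degenerate non-zero 2-form on `ℝ⁴` has dimension at least `2`** (two
independent columns of the Pfaffian adjugate). [folklore] -/
theorem two_le_finrank_altKer (hP : pfaffian α = 0) (hα : α ≠ 0) : 2 ≤ finrank ℝ (altKer α) := by
  obtain ⟨k, l, hind⟩ := exists_linearIndependent_pfaffAdjCol α hα
  have h2 : finrank ℝ (Submodule.span ℝ (Set.range ![pfaffAdjCol α k, pfaffAdjCol α l])) = 2 := by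
    rw [finrank_span_eq_card hind]
    simp
  have hle : Submodule.span ℝ (Set.range ![pfaffAdjCol α k, pfaffAdjCol α l]) ≤ altKer α := by
    refine Submodule.span_le.2 ?_
    rintro _ ⟨m, rfl⟩
    fin_cases m
    · exact pfaffAdjCol_mem_altKer α hP k
    · exact pfaffAdjCol_mem_altKer α hP l
  rw [← h2]
  exact Submodule.finrank_mono hle

/-- **`rank = 2` on the fold**: a degenerate non-zero 2-form on `ℝ⁴` has a radical of dimension
exactly `2` (the rank of an alternating form is even); Def. 2.1: on the fold "`E` is the rank `2`
bundle … whose fiber at each point is the kernel of `ω`". [cite: CannasdasilvaGuilleminPires2010, Def. 2.1] -/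
theorem finrank_altKer_eq_two (hP : pfaffian α = 0) (hα : α ≠ 0) : finrank ℝ (altKer α) = 2 :=
  le_antisymm (finrank_altKer_le_two α hα) (two_le_finrank_altKer α hP hα)

end AltKer

/-! ### The Pfaffian has vanishing derivative at `0`; the form is non-zero on the fold -/

section NonZero

/-- The Pfaffian is an even function of the form: `Pf (-α) = Pf α` (it is homogeneous of
degree `2`, `pfaffian_smul`). [folklore] -/
theorem pfaffian_neg (α : (EuclideanSpace ℝ (Fin 4)) [⋀^Fin 2]→L[ℝ] ℝ) :
    pfaffian (-α) = pfaffian α := by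
  rw [show -α = (-1 : ℝ) • α from (neg_one_smul ℝ α).symm, pfaffian_smul]
  norm_num

/-- **`dPf(0) = 0`**: the Pfaffian, being even (`pfaffian_neg`) and differentiable, has zero
derivative at the zero form (`dPf(0) = dPf(0) ∘ (-id)`). [folklore] -/
theorem fderiv_pfaffian_zero :
    fderiv ℝ (fun α : (EuclideanSpace ℝ (Fin 4)) [⋀^Fin 2]→L[ℝ] ℝ => pfaffian α) 0 = 0 := by
  set f := fun α : (EuclideanSpace ℝ (Fin 4)) [⋀^Fin 2]→L[ℝ] ℝ => pfaffian α with hf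
  have hdiff : DifferentiableAt ℝ f 0 := contDiff_pfaffian.contDiffAt.differentiableAt (by simp)
  have heven : f = f ∘ Neg.neg := by
    funext α
    simp only [hf, comp_apply, pfaffian_neg]
  have hneg : HasFDerivAt (Neg.neg : ((EuclideanSpace ℝ (Fin 4)) [⋀^Fin 2]→L[ℝ] ℝ) →
      (EuclideanSpace ℝ (Fin 4)) [⋀^Fin 2]→L[ℝ] ℝ)
      (-ContinuousLinearMap.id ℝ _) 0 := (hasFDerivAt_id _).neg
  have hdiff' : DifferentiableAt ℝ f (-0) := by rw [neg_zero]; exact hdiff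
  have hcomp : fderiv ℝ (f ∘ Neg.neg) 0 = (fderiv ℝ f (-0)).comp (-ContinuousLinearMap.id ℝ _) := by
    rw [fderiv_comp 0 hdiff' hneg.differentiableAt, hneg.fderiv]
  rw [neg_zero] at hcomp
  have key : fderiv ℝ f 0 = -fderiv ℝ f 0 := by
    conv_lhs => rw [heven, hcomp]
    ext v
    simp
  have h2 : (2 : ℝ) • fderiv ℝ f 0 = 0 := by
    rw [two_smul]
    nth_rewrite 2 [key]
    exact add_neg_cancel (fderiv ℝ f 0)
  exact (smul_eq_zero.1 h2).resolve_left two_ne_zero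

variable {M : Type*} [TopologicalSpace M] [ChartedSpace (EuclideanSpace ℝ (Fin 4)) M]
  {N : Type} [TopologicalSpace N] [ChartedSpace (EuclideanSpace ℝ (Fin 3)) N] {j : N → M}

/-- **A folded form does not vanish at its fold points**: if `s x₀ = 0` then the chart
representative of `s` vanishes at the centre `c` of the chart, and since `dPf(0) = 0` the chart
Pfaffian would have zero derivative at `c`, contradicting `ω ∧ ω ⋔ 0`. Hence on the fold the
kernel of `ω` is the `2`-plane `E` of Def. 2.1 (`finrank_altKer_eq_two`), not all of `T M`.
[cite: CannasdasilvaGuilleminPires2010, Def. 2.1] -/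
theorem IsFoldedForm.apply_ne_zero {s : MForm (𝓡 4) M ℝ 2} (h : IsFoldedForm s N j) {x₀ : M}
    (hx₀ : x₀ ∈ fold s) : s x₀ ≠ 0 := by
  intro hs0
  apply h.transverse x₀ hx₀
  have hA : DifferentiableAt ℝ (s.inChart x₀) (extChartAt (𝓡 4) x₀ x₀) := by
    have h1 := h.smooth x₀
    rw [ModelWithCorners.Boundaryless.range_eq_univ] at h1
    exact (h1.contDiffAt Filter.univ_mem).differentiableAt (by simp)
  have hAc : s.inChart x₀ (extChartAt (𝓡 4) x₀ x₀) = 0 := by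
    have key : ∀ {p q : M} (_ : p = q)
        (L : EuclideanSpace ℝ (Fin 4) →L[ℝ] EuclideanSpace ℝ (Fin 4)), s q = 0 →
        (s p).compContinuousLinearMap L = 0 := by
      intro p q hpq L hq
      subst hpq
      rw [hq]
      ext v
      rfl
    exact key (extChartAt_to_inv (I := 𝓡 4) x₀) _ hs0
  have hcomp : (fun y => pfaffian (s.inChart x₀ y)) =
      (fun α : (EuclideanSpace ℝ (Fin 4)) [⋀^Fin 2]→L[ℝ] ℝ => pfaffian α) ∘ s.inChart x₀ := rfl
  rw [hcomp, fderiv_comp _ (contDiff_pfaffian.contDiffAt.differentiableAt (by simp)) hA, hAc,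
    fderiv_pfaffian_zero, ContinuousLinearMap.zero_comp]

end NonZero

/-! ### The null line field `V = T Z ∩ ker ω` -/

section NullLine

variable {M : Type*} [TopologicalSpace M] [ChartedSpace (EuclideanSpace ℝ (Fin 4)) M]
  [IsManifold (𝓡 4) ∞ M]
  {N : Type} [TopologicalSpace N] [ChartedSpace (EuclideanSpace ℝ (Fin 3)) N]
  [IsManifold (𝓡 3) ∞ N] {j : N → M}

omit [IsManifold (𝓡 4) ∞ M] [IsManifold (𝓡 3) ∞ N] in
/-- On the fold of a folded form the radical `E = ker ω` is a `2`-plane (Def. 2.1: "`E` is the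
rank `2` bundle over `Z` whose fiber at each point is the kernel of `ω`"). [cite: CannasdasilvaGuilleminPires2010, Def. 2.1] -/
theorem IsFoldedForm.finrank_altKer {s : MForm (𝓡 4) M ℝ 2} (h : IsFoldedForm s N j) (n : N) :
    finrank ℝ (altKer (s (j n))) = 2 := by
  have hmem : j n ∈ fold s := by
    rw [← h.range_eq]
    exact mem_range_self n
  exact finrank_altKer_eq_two _ ((mem_fold_iff_pfaffian_eq_zero s _).1 hmem)
    (h.apply_ne_zero hmem)

omit [IsManifold (𝓡 4) ∞ M] [IsManifold (𝓡 3) ∞ N] in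
/-- The span of the range of the linear map `d j_n` is its range. [folklore] -/
theorem span_range_mfderiv_eq (n : N) :
    Submodule.span ℝ (Set.range (mfderiv (𝓡 3) (𝓡 4) j n)) =
      LinearMap.range (mfderiv (𝓡 3) (𝓡 4) j n).toLinearMap := by
  apply le_antisymm
  · refine Submodule.span_le.2 ?_
    rintro _ ⟨u, rfl⟩
    exact ⟨u, rfl⟩
  · rintro _ ⟨u, rfl⟩
    exact Submodule.subset_span ⟨u, rfl⟩

/-- The tangent space `T_{j n} Z = range (d j_n)` of the folding hypersurface is `3`-dimensional
(`j` is an immersion: `Literature.Topology.FourManifolds.Manifold.IsImmersionAt.mfderiv_injective`).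
[cite: CannasdasilvaGuilleminPires2010, Def. 2.1] -/
theorem IsFoldedForm.finrank_range_mfderiv {s : MForm (𝓡 4) M ℝ 2} (h : IsFoldedForm s N j)
    (n : N) : finrank ℝ (LinearMap.range (mfderiv (𝓡 3) (𝓡 4) j n).toLinearMap) = 3 := by
  have hinj : Injective (mfderiv (𝓡 3) (𝓡 4) j n) :=
    Literature.Topology.FourManifolds.Manifold.IsImmersionAt.mfderiv_injective
      (h.embedding.isImmersion.isImmersionAt n) (by simp)
  rw [LinearMap.finrank_range_of_inj hinj]
  exact finrank_euclideanSpace_fin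

/-- The tangent space of the fold, as the span of the range of `d j_n` inside `T_{j n} M = ℝ⁴`,
is `3`-dimensional. [cite: CannasdasilvaGuilleminPires2010, Def. 2.1] -/
theorem IsFoldedForm.finrank_span_range_mfderiv {s : MForm (𝓡 4) M ℝ 2} (h : IsFoldedForm s N j)
    (n : N) :
    finrank ℝ (Submodule.span ℝ (Set.range (mfderiv (𝓡 3) (𝓡 4) j n)) :
      Submodule ℝ (EuclideanSpace ℝ (Fin 4))) = 3 := by
  have h3 := h.finrank_range_mfderiv n
  have e : Submodule.span ℝ (Set.range (mfderiv (𝓡 3) (𝓡 4) j n)) =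
      LinearMap.range (mfderiv (𝓡 3) (𝓡 4) j n).toLinearMap :=
    span_range_mfderiv_eq n
  rw [← e] at h3
  exact h3

omit [IsManifold (𝓡 4) ∞ M] [IsManifold (𝓡 3) ∞ N] in
/-- The span of the range of `d j_n` is the range, as a set. [folklore] -/
theorem coe_span_range_mfderiv (n : N) :
    ((Submodule.span ℝ (Set.range (mfderiv (𝓡 3) (𝓡 4) j n)) :
      Submodule ℝ (EuclideanSpace ℝ (Fin 4))) : Set (EuclideanSpace ℝ (Fin 4))) =
      Set.range (mfderiv (𝓡 3) (𝓡 4) j n) := by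
  have e : Submodule.span ℝ (Set.range (mfderiv (𝓡 3) (𝓡 4) j n)) =
      LinearMap.range (mfderiv (𝓡 3) (𝓡 4) j n).toLinearMap :=
    span_range_mfderiv_eq n
  have := congrArg (fun p : Submodule ℝ (TangentSpace (𝓡 4) (j n)) =>
    (p : Set (TangentSpace (𝓡 4) (j n)))) e
  simp only [LinearMap.coe_range] at this
  exact this

/-- **The null line field** (Def. 2.1: "The induced restriction `i*ω` has a one-dimensional
kernel at each point: the line field `V` on `Z` … `V = TZ ∩ E`"): for a folded form, at every
fold point `TZ ∩ ker ω` is a line — `dim E = 2`, `dim TZ = 3`, `E ⊄ TZ` (maximal rank) so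
`E + TZ = ℝ⁴`, and Grassmann's formula. [cite: CannasdasilvaGuilleminPires2010, Def. 2.1] -/
theorem IsFoldedForm.finrank_altKer_inf_range {s : MForm (𝓡 4) M ℝ 2} (h : IsFoldedForm s N j)
    (n : N) :
    finrank ℝ ↥(altKer (s (j n)) ⊓
      (Submodule.span ℝ (Set.range (mfderiv (𝓡 3) (𝓡 4) j n)) :
        Submodule ℝ (EuclideanSpace ℝ (Fin 4)))) = 1 := by
  set K : Submodule ℝ (EuclideanSpace ℝ (Fin 4)) := altKer (s (j n)) with hK
  set R : Submodule ℝ (EuclideanSpace ℝ (Fin 4)) :=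
    Submodule.span ℝ (Set.range (mfderiv (𝓡 3) (𝓡 4) j n)) with hR
  have hKd : finrank ℝ K = 2 := h.finrank_altKer n
  have hRd : finrank ℝ R = 3 := h.finrank_span_range_mfderiv n
  have hnot : ¬ K ≤ R := by
    obtain ⟨v, hv, hvR⟩ := h.maximalRank n
    intro hle
    apply hvR
    have hvK : v ∈ K := (mem_altKer_iff _).2 hv
    have hvR' : (v : EuclideanSpace ℝ (Fin 4)) ∈ (R : Set (EuclideanSpace ℝ (Fin 4))) := hle hvK
    rw [hR, coe_span_range_mfderiv] at hvR'
    exact hvR'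
  have hlt : R < K ⊔ R := by
    refine lt_of_le_of_ne le_sup_right fun heq => hnot ?_
    rw [heq]
    exact le_sup_left
  have h4 : finrank ℝ ↥(K ⊔ R) = 4 := by
    have hgt := Submodule.finrank_lt_finrank_of_lt hlt
    have hle := Submodule.finrank_le (K ⊔ R)
    rw [finrank_euclideanSpace_fin] at hle
    omega
  have key := Submodule.finrank_sup_add_finrank_inf_eq K R
  omega

end NullLine


/-! ### The null foliation is spanned by the generator of the circle action -/

section Origami

open Literature.Geometry.Manifold

variable {M : Type*} [TopologicalSpace M] [ChartedSpace (EuclideanSpace ℝ (Fin 4)) M]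
  [IsManifold (𝓡 4) ∞ M]
  {N : Type} [TopologicalSpace N] [ChartedSpace (EuclideanSpace ℝ (Fin 3)) N]
  [IsManifold (𝓡 3) ∞ N] {j : N → M} {θ : Circle → N → N}

omit [IsManifold (𝓡 4) ∞ M] [IsManifold (𝓡 3) ∞ N] in
/-- **Chain rule for the null vector**: the velocity of `t ↦ j (θ (exp t) n)` at `0` is the image
under `d j_n` of the fundamental vector `d/dt|₀ θ (exp t) n` of the action (this is the vector
in the tangency clause of `IsOrigamiForm`). [folklore] -/
theorem mfderiv_comp_circleOrbit_apply (hj : ContMDiff (𝓡 3) (𝓡 4) ∞ j)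
    (hθ : ContMDiff ((𝓡 1).prod (𝓡 3)) (𝓡 3) ∞ (fun p : Circle × N => θ p.1 p.2))
    (h1 : ∀ n, θ 1 n = n) (n : N) :
    mfderiv 𝓘(ℝ, ℝ) (𝓡 4) (fun t : ℝ => j (θ (Circle.exp t) n)) 0 (1 : ℝ) =
      mfderiv (𝓡 3) (𝓡 4) j n
        (mfderiv 𝓘(ℝ, ℝ) (𝓡 3) (fun t : ℝ => θ (Circle.exp t) n) 0 (1 : ℝ)) := by
  have hγ : MDifferentiableAt 𝓘(ℝ, ℝ) (𝓡 3) (fun t : ℝ => θ (Circle.exp t) n) 0 :=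
    (contMDiff_circleOrbit hθ n).mdifferentiableAt (by decide)
  have hjd : MDifferentiableAt (𝓡 3) (𝓡 4) j (θ (Circle.exp 0) n) :=
    hj.mdifferentiableAt (by decide)
  have hcomp := (hjd.hasMFDerivAt.comp 0 hγ.hasMFDerivAt).mfderiv
  have h0 : θ (Circle.exp 0) n = n := by rw [Circle.exp_zero, h1]
  rw [h0] at hcomp
  rw [show (fun t : ℝ => j (θ (Circle.exp t) n)) = j ∘ fun t : ℝ => θ (Circle.exp t) n from rfl,
    hcomp]
  rfl

/-- **The null vector of a free circle action tangent to the fold is non-zero**: `d j_n` is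
injective (`j` an immersion) and the fundamental vector of a free action does not vanish
(`Literature.Geometry.Manifold.mfderiv_circleOrbit_apply_one_ne_zero`).
[cite: CannasdasilvaGuilleminPires2010, Def. 2.2] -/
theorem mfderiv_comp_circleOrbit_ne_zero (hj : Manifold.IsSmoothEmbedding (𝓡 3) (𝓡 4) ∞ j)
    (hθ : ContMDiff ((𝓡 1).prod (𝓡 3)) (𝓡 3) ∞ (fun p : Circle × N => θ p.1 p.2))
    (h1 : ∀ n, θ 1 n = n) (hmul : ∀ a b n, θ (a * b) n = θ a (θ b n))
    (hfree : ∀ a n, θ a n = n → a = 1) (n : N) :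
    mfderiv 𝓘(ℝ, ℝ) (𝓡 4) (fun t : ℝ => j (θ (Circle.exp t) n)) 0 (1 : ℝ) ≠ 0 := by
  rw [mfderiv_comp_circleOrbit_apply hj.contMDiff hθ h1 n]
  have hinj : Injective (mfderiv (𝓡 3) (𝓡 4) j n) :=
    Literature.Topology.FourManifolds.Manifold.IsImmersionAt.mfderiv_injective
      (hj.isImmersion.isImmersionAt n) (by simp)
  intro h0
  apply mfderiv_circleOrbit_apply_one_ne_zero hθ h1 hmul hfree n
  apply hinj
  rw [h0]
  exact (map_zero (mfderiv (𝓡 3) (𝓡 4) j n)).symm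

omit [IsManifold (𝓡 4) ∞ M] [IsManifold (𝓡 3) ∞ N] in
/-- The null vector is tangent to the fold: it lies in the range of `d j_n`. [folklore] -/
theorem mfderiv_comp_circleOrbit_mem_range (hj : ContMDiff (𝓡 3) (𝓡 4) ∞ j)
    (hθ : ContMDiff ((𝓡 1).prod (𝓡 3)) (𝓡 3) ∞ (fun p : Circle × N => θ p.1 p.2))
    (h1 : ∀ n, θ 1 n = n) (n : N) :
    mfderiv 𝓘(ℝ, ℝ) (𝓡 4) (fun t : ℝ => j (θ (Circle.exp t) n)) 0 (1 : ℝ) ∈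
      Set.range (mfderiv (𝓡 3) (𝓡 4) j n) :=
  ⟨_, (mfderiv_comp_circleOrbit_apply hj hθ h1 n).symm⟩

/-- **The null foliation is the vertical bundle of the null fibration** (Def. 2.2, "whose null
foliation integrates to a principal `S¹`-fibration"; discussion after Def. 2.5: "The null
foliation `V` is the vertical bundle of `π`"): for fold data `(N, j, θ)` of an origami form — a
folded form with a free smooth circle action on the folding hypersurface whose orbits are
tangent to `ker ω` — the null line `TZ ∩ ker ω` at `j n` is spanned by the (non-zero) velocity of
the orbit through `n`. [cite: CannasdasilvaGuilleminPires2010, Def. 2.2] -/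
theorem IsFoldedForm.altKer_inf_span_range_eq_span {s : MForm (𝓡 4) M ℝ 2}
    (h : IsFoldedForm s N j)
    (hθ : ContMDiff ((𝓡 1).prod (𝓡 3)) (𝓡 3) ∞ (fun p : Circle × N => θ p.1 p.2))
    (h1 : ∀ n, θ 1 n = n) (hmul : ∀ a b n, θ (a * b) n = θ a (θ b n))
    (hfree : ∀ a n, θ a n = n → a = 1)
    (htan : ∀ (n : N) (w : TangentSpace (𝓡 4) (j n)),
      s (j n) ![mfderiv 𝓘(ℝ, ℝ) (𝓡 4) (fun t : ℝ => j (θ (Circle.exp t) n)) 0 (1 : ℝ), w] = 0)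
    (n : N) :
    altKer (s (j n)) ⊓ (Submodule.span ℝ (Set.range (mfderiv (𝓡 3) (𝓡 4) j n)) :
        Submodule ℝ (EuclideanSpace ℝ (Fin 4))) =
      ℝ ∙ (mfderiv 𝓘(ℝ, ℝ) (𝓡 4) (fun t : ℝ => j (θ (Circle.exp t) n)) 0 (1 : ℝ) :
        EuclideanSpace ℝ (Fin 4)) := by
  set X : EuclideanSpace ℝ (Fin 4) :=
    mfderiv 𝓘(ℝ, ℝ) (𝓡 4) (fun t : ℝ => j (θ (Circle.exp t) n)) 0 (1 : ℝ) with hX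
  have hX0 : X ≠ 0 := mfderiv_comp_circleOrbit_ne_zero h.embedding hθ h1 hmul hfree n
  have hXK : X ∈ altKer (s (j n)) := (mem_altKer_iff _).2 (htan n)
  have hXR : X ∈ (Submodule.span ℝ (Set.range (mfderiv (𝓡 3) (𝓡 4) j n)) :
      Submodule ℝ (EuclideanSpace ℝ (Fin 4))) :=
    Submodule.subset_span (mfderiv_comp_circleOrbit_mem_range h.embedding.contMDiff hθ h1 n)
  have hle : (ℝ ∙ X) ≤ altKer (s (j n)) ⊓
      (Submodule.span ℝ (Set.range (mfderiv (𝓡 3) (𝓡 4) j n)) :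
        Submodule ℝ (EuclideanSpace ℝ (Fin 4))) := by
    rw [Submodule.span_singleton_le_iff_mem]
    exact ⟨hXK, hXR⟩
  have hfin : finrank ℝ (ℝ ∙ X) = 1 := finrank_span_singleton hX0
  exact (Submodule.eq_of_le_of_finrank_eq hle
    (hfin.trans (h.finrank_altKer_inf_range n).symm)).symm

omit [IsManifold (𝓡 4) ∞ M] in
/-- An origami form does not vanish at its fold points. [cite: CannasdasilvaGuilleminPires2010, Def. 2.1] -/
theorem IsOrigamiForm.apply_ne_zero {s : MForm (𝓡 4) M ℝ 2} (h : IsOrigamiForm s) {x : M}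
    (hx : x ∈ fold s) : s x ≠ 0 := by
  obtain ⟨N, _, _, _, _, j, hf⟩ := h.exists_isFoldedForm
  exact hf.apply_ne_zero hx

omit [IsManifold (𝓡 4) ∞ M] in
/-- **On the fold of an origami form `ker ω` is a `2`-plane** (the bundle `E` of Def. 2.1).
[cite: CannasdasilvaGuilleminPires2010, Def. 2.1] -/
theorem IsOrigamiForm.finrank_altKer {s : MForm (𝓡 4) M ℝ 2} (h : IsOrigamiForm s) {x : M}
    (hx : x ∈ fold s) : finrank ℝ (altKer (s x)) = 2 := by
  obtain ⟨N, _, _, _, _, j, hf⟩ := h.exists_isFoldedForm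
  have hx' : x ∈ Set.range j := by rwa [hf.range_eq]
  obtain ⟨n, rfl⟩ := hx'
  exact hf.finrank_altKer n

end Origami

end Literature.Geometry.Symplectic

end
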